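import Literature.Probability.LatticeModels.SRWReturnFourier
import HarnessLib

/-!
# Line «sandwich_discharge» on crux `HistoryTailL` (stmt-QuantumFields-19936), stub `stub_sandwichSweepGapCapped` (S′), brick B5 on `ℤ³`, (Z-d) —
# THE DISCRETE SECOND RIESZ TRANSFORMS `∇_a∇_bΔ⁻¹` ON `ℤ^d` ARE `ℓ²`-BOUNDED — via Bessel's inequality on the Brillouin zone

Cell `ym3-torus` (YM ladder rung R3 = continuum SU(2) Yang–Mills on the three-torus — a RUNG, NOT the Clay problem); TWIN-WIDTH helper seat
`ym-ust-19936-w8` gen 8; `--supports stmt-QuantumFields-19936` (helper; LOCATE-B5-Z3-COMMUTATOR-w8g8 §5∕§6 (Z-d): the `j`-uniform `ℓ²` cost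
`Σ(d a_R)² ≤ A₂L^j` of the sweep amplitude needs exactly this multiplier bound; a pointwise route loses `log²`).  Generic `ℤ^d` Fourier analysis
over lit `Literature/Probability/LatticeModels` (`SRWReturnFourier.lean` (orthogonality of the characters `θ ↦ e^{iθ·x}`,
`x ∈ ℤ^d`: `SRW.integral_brillouin_cexp_phase`) and `LatticeGreenFunction.lean` (the Brillouin zone `brillouin d`, the dispersion
`ε(θ) = Σᵢ(1 − cos θᵢ)`, the lattice Green function `latticeGreen z = ∫ cos(θ·z)∕ε(θ) dθ∕(2π)^d`, twice the Green function of `−Δ_{ℤ^d}`).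
THEOREMS ONLY (0 `def`, 0 named fact, default heartbeats), all PROVED; nothing here proves B5, the stub, `HistoryTailL` or any summit statement:
* §1 `integral_brillouin_cexp_mul_conj_cexp` — `∫_{[-π,π]^d} e^{iθ·x}\overline{e^{iθ·y}} dθ = (2π)^d [x = y]`;
* §2 `integral_norm_sq_trigPoly_eq` — **PARSEVAL FOR TRIGONOMETRIC POLYNOMIALS**: `∫ |∑_{x∈B} a_x \overline{e^{iθ·x}}|² dθ = (2π)^d ∑_{x∈B} |a_x|²`;
  `sum_norm_sq_fourierCoeff_le` — **BESSEL'S INEQUALITY, finite form**: for `g` integrable with integrable `|g|²` on `[-π,π]^d` and a finite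
  `B ⊆ ℤ^d`, `∑_{x ∈ B} |∫ g(θ) e^{iθ·x} dθ|² ≤ (2π)^d ∫ |g(θ)|² dθ` (expand `0 ≤ ∫|g − (2π)^{−d}Q|²`, `Q = ∑_{x∈B} c_x\overline{e^{iθ·x}}`);
* §3 `norm_rieszMultiplier_le` — the Fourier multiplier of `∇_a∇_b(−Δ)⁻¹·2`, `(e^{iθ_a} − 1)(e^{iθ_b} − 1)∕ε(θ)`, has modulus `≤ 2`
  (`|e^{ia} − 1|² = 2(1 − cos a)`, AM–GM); `latticeGreen_eq_re_integral` — `G(z) = Re(∫ e^{iθ·z}ε(θ)⁻¹dθ)∕(2π)^d` (`d ≥ 3`);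
  ★ `sum_sq_secondDiff_latticeGreen_conv_le` — **for `d ≥ 3`, every real charge `ω` on a finite `S ⊆ ℤ^d` and every finite box `B`:
  `∑_{x∈B} (∑_{y∈S} ω(y)·∇_a∇_b G(x − y))² ≤ 4·∑_{y∈S} ω(y)²`** (`∇_a∇_bG(z) = G(z+e_a+e_b) − G(z+e_a) − G(z+e_b) + G(z)`), uniformly in
  `B`, `S` — the `ℓ²`-boundedness of the discrete Calderón–Zygmund kernels `∇∇Δ⁻¹` on finitely supported charges, with constant `2` for
  `G = latticeGreen` (`1` for the Green function `G∕2` of `−Δ`).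
WHAT IS NOT HERE: no `L²(𝕋^d)` completeness ∕ Plancherel for infinite sequences (not needed for finitely supported charges); no sharp constant.
[folklore] (Bessel: Katznelson, *An Introduction to Harmonic Analysis* (2004), Ch. I §5; Riesz transforms: Lawler–Limic (2010) §4.4).  Rung R3, not Clay.
-/

noncomputable section

open MeasureTheory Complex Finset Real
open scoped ComplexConjugate

namespace Summit.QuantumFields.YangMills.Theorems.CovariantDischargeLatticeRieszL2

open Literature.Probability.LatticeModels
open Literature.Probability.LatticeModels.SRW (phase phase_add integral_brillouin_cexp_phase)

variable {d : ℕ}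

/-! ## §1 Characters -/

/-- The character `e^{iθ·x}` has norm one. [folklore] -/
theorem norm_cexp_I_phase (θ : Fin d → ℝ) (x : Site d) : ‖cexp (I * phase θ x)‖ = 1 := by
  rw [show I * (phase θ x : ℂ) = ((phase θ x : ℝ) : ℂ) * I by ring, Complex.norm_exp_ofReal_mul_I]

/-- `\overline{e^{iθ·y}} = e^{−iθ·y}` and `e^{iθ·x}\overline{e^{iθ·y}} = e^{iθ·(x−y)}`. [folklore] -/
theorem cexp_mul_conj_cexp (θ : Fin d → ℝ) (x y : Site d) :
    cexp (I * phase θ x) * conj (cexp (I * phase θ y)) = cexp (I * phase θ (x - y)) := by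
  rw [← Complex.exp_conj, ← Complex.exp_add]
  congr 1
  have h := phase_add θ (x - y) y
  rw [sub_add_cancel] at h
  rw [show phase θ (x - y) = phase θ x - phase θ y by linarith, map_mul, Complex.conj_I, Complex.conj_ofReal]
  push_cast
  ring

/-- The character is continuous in `θ`. [folklore] -/
theorem continuous_cexp_I_phase (x : Site d) : Continuous fun θ : Fin d → ℝ => cexp (I * phase θ x) := by
  unfold phase; fun_prop

/-- **Orthogonality with conjugates**: `∫_{[-π,π]^d} e^{iθ·x}\overline{e^{iθ·y}} dθ = (2π)^d [x = y]`. [folklore] -/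
theorem integral_brillouin_cexp_mul_conj_cexp (x y : Site d) :
    ∫ θ in brillouin d, cexp (I * phase θ x) * conj (cexp (I * phase θ y)) =
      if x = y then (((2 * π : ℝ) : ℂ)) ^ d else 0 := by
  simp_rw [cexp_mul_conj_cexp]
  rw [integral_brillouin_cexp_phase (x - y)]
  simp [sub_eq_zero]


/-! ## §2 Bessel's inequality (finite form) -/


/-- `|z|² = Re(z \bar z)`. [folklore] -/
theorem norm_sq_eq_re_mul_conj (z : ℂ) : ‖z‖ ^ 2 = (z * conj z).re := by
  rw [Complex.mul_conj, Complex.sq_norm]; simp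

/-- ★ **PARSEVAL FOR TRIGONOMETRIC POLYNOMIALS on `[-π,π]^d`**: for complex coefficients `a_x` on a finite set `B ⊆ ℤ^d`,
`∫ |∑_{x∈B} a_x \overline{e^{iθ·x}}|² dθ = (2π)^d ∑_{x∈B} |a_x|²` (expand the square, integrate the characters by orthogonality). [folklore] -/
theorem integral_norm_sq_trigPoly_eq (a : Site d → ℂ) (B : Finset (Site d)) :
    ∫ θ in brillouin d, ‖∑ x ∈ B, a x * conj (cexp (I * phase θ x))‖ ^ 2 = (2 * π) ^ d * ∑ x ∈ B, ‖a x‖ ^ 2 := by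
  set μ : Measure (Fin d → ℝ) := volume.restrict (brillouin d) with hμ
  haveI : IsFiniteMeasure μ := ⟨by rw [hμ, Measure.restrict_apply_univ]; exact (isCompact_brillouin d).measure_lt_top⟩
  set e : Site d → (Fin d → ℝ) → ℂ := fun x θ => cexp (I * phase θ x) with he
  set Q : (Fin d → ℝ) → ℂ := fun θ => ∑ x ∈ B, a x * conj (e x θ) with hQ
  have he_cont : ∀ x, Continuous (e x) := fun x => continuous_cexp_I_phase x
  have he_norm : ∀ x θ, ‖e x θ‖ = 1 := fun x θ => norm_cexp_I_phase θ x
  have hQ_cont : Continuous Q :=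
    continuous_finsetSum _ fun x _ => continuous_const.mul (Complex.continuous_conj.comp (he_cont x))
  have hQ_bdd : ∀ θ, ‖Q θ‖ ≤ ∑ x ∈ B, ‖a x‖ := fun θ =>
    (norm_sum_le _ _).trans (Finset.sum_le_sum fun x _ => by rw [norm_mul, Complex.norm_conj, he_norm, mul_one])
  have hee : ∀ x x', Integrable (fun θ => e x θ * conj (e x' θ)) μ := fun x x' =>
    (integrable_const (1 : ℝ)).mono' ((he_cont x).mul (Complex.continuous_conj.comp (he_cont x'))).aestronglyMeasurable
      (Filter.Eventually.of_forall fun θ => by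
        rw [norm_mul, Complex.norm_conj, he_norm, he_norm, mul_one])
  have h1 : ∀ θ, (‖Q θ‖ ^ 2 : ℝ) = (Q θ * conj (Q θ)).re := fun θ => norm_sq_eq_re_mul_conj (Q θ)
  have hQQ : Integrable (fun θ => Q θ * conj (Q θ)) μ := by
    refine (integrable_const ((∑ x ∈ B, ‖a x‖) ^ 2 : ℝ)).mono'
      (hQ_cont.mul (Complex.continuous_conj.comp hQ_cont)).aestronglyMeasurable
      (Filter.Eventually.of_forall fun θ => ?_)
    rw [norm_mul, Complex.norm_conj, ← sq]
    exact pow_le_pow_left₀ (norm_nonneg _) (hQ_bdd θ) 2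
  change ∫ θ, ‖Q θ‖ ^ 2 ∂μ = _
  simp_rw [h1]
  have hre := integral_re hQQ
  simp only [RCLike.re_to_complex] at hre
  rw [hre]
  have h2 : ∀ θ, Q θ * conj (Q θ) = ∑ x ∈ B, ∑ x' ∈ B, (a x' * conj (a x)) * (e x θ * conj (e x' θ)) := by
    intro θ
    simp only [hQ, map_sum, map_mul, Complex.conj_conj, Finset.sum_mul, Finset.mul_sum]
    refine Finset.sum_congr rfl fun x _ => Finset.sum_congr rfl fun x' _ => by ring
  simp_rw [h2]
  rw [integral_finsetSum _ fun x _ => integrable_finsetSum _ fun x' _ => (hee x x').const_mul _]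
  simp_rw [integral_finsetSum _ fun x' _ => (hee _ x').const_mul _, integral_const_mul]
  have h3 : ∀ x x', (∫ θ, e x θ * conj (e x' θ) ∂μ) = if x = x' then (((2 * π) ^ d : ℝ) : ℂ) else 0 := by
    intro x x'; rw [hμ, integral_brillouin_cexp_mul_conj_cexp x x']; push_cast; rfl
  simp_rw [h3, mul_ite, mul_zero, Finset.sum_ite_eq]
  rw [Complex.re_sum, Finset.mul_sum]
  refine Finset.sum_congr rfl fun x hx => ?_
  rw [if_pos hx, Complex.mul_conj']; norm_cast; ring

/-- ★★ **BESSEL'S INEQUALITY ON THE BRILLOUIN ZONE (finite form).**  For `g` integrable with integrable `|g|²` on `[-π,π]^d` and a finite set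
`B ⊆ ℤ^d` of frequencies, `∑_{x∈B} |∫ g(θ)e^{iθ·x} dθ|² ≤ (2π)^d · ∫ |g(θ)|² dθ`.  Proof: with `c_x := ∫ g e^{iθ·x}` and
`Q := ∑_{x∈B} c_x \overline{e^{iθ·x}}`, `0 ≤ ∫|g − λQ|² = ∫|g|² − 2λ∑|c_x|² + λ²(2π)^d∑|c_x|²` at `λ = (2π)^{−d}`. [folklore] -/
theorem sum_norm_sq_fourierCoeff_le (g : (Fin d → ℝ) → ℂ) (hg : IntegrableOn g (brillouin d))
    (hg2 : IntegrableOn (fun θ => ‖g θ‖ ^ 2) (brillouin d)) (B : Finset (Site d)) :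
    ∑ x ∈ B, ‖∫ θ in brillouin d, g θ * cexp (I * phase θ x)‖ ^ 2 ≤
      (2 * π) ^ d * ∫ θ in brillouin d, ‖g θ‖ ^ 2 := by
  set μ : Measure (Fin d → ℝ) := volume.restrict (brillouin d) with hμ
  haveI : IsFiniteMeasure μ := ⟨by rw [hμ, Measure.restrict_apply_univ]; exact (isCompact_brillouin d).measure_lt_top⟩
  set c : Site d → ℂ := fun x => ∫ θ in brillouin d, g θ * cexp (I * phase θ x) with hc
  set e : Site d → (Fin d → ℝ) → ℂ := fun x θ => cexp (I * phase θ x) with he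
  set Q : (Fin d → ℝ) → ℂ := fun θ => ∑ x ∈ B, c x * conj (e x θ) with hQ
  set S : ℝ := ∑ x ∈ B, ‖c x‖ ^ 2 with hS
  set Λ : ℝ := (2 * π) ^ d with hΛ
  have hΛpos : 0 < Λ := by positivity
  -- continuity / boundedness of the characters and of `Q`
  have he_cont : ∀ x, Continuous (e x) := fun x => continuous_cexp_I_phase x
  have he_norm : ∀ x θ, ‖e x θ‖ = 1 := fun x θ => norm_cexp_I_phase θ x
  have hQ_cont : Continuous Q :=
    continuous_finsetSum _ fun x _ => continuous_const.mul (Complex.continuous_conj.comp (he_cont x))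
  have hQ_bdd : ∀ θ, ‖Q θ‖ ≤ ∑ x ∈ B, ‖c x‖ := fun θ =>
    (norm_sum_le _ _).trans (Finset.sum_le_sum fun x _ => by rw [norm_mul, Complex.norm_conj, he_norm, mul_one])
  -- integrability of the pieces (w.r.t. the finite measure `μ`)
  have hgμ : Integrable g μ := hg
  have hg2μ : Integrable (fun θ => ‖g θ‖ ^ 2) μ := hg2
  have hge : ∀ x, Integrable (fun θ => g θ * e x θ) μ := fun x =>
    hgμ.mul_bdd (he_cont x).aestronglyMeasurable (Filter.Eventually.of_forall fun θ => (he_norm x θ).le) |>.congr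
      (Filter.Eventually.of_forall fun θ => by simp)
  have hgQ : Integrable (fun θ => g θ * conj (Q θ)) μ := by
    have hbd : ∀ᵐ θ ∂μ, ‖(⇑(starRingEnd ℂ) ∘ Q) θ‖ ≤ ∑ x ∈ B, ‖c x‖ :=
      Filter.Eventually.of_forall fun θ => by rw [Function.comp_apply, Complex.norm_conj]; exact hQ_bdd θ
    exact (hgμ.mul_bdd (Complex.continuous_conj.comp hQ_cont).aestronglyMeasurable hbd).congr
      (Filter.Eventually.of_forall fun θ => by simp)
  have hQ2 : Integrable (fun θ => ‖Q θ‖ ^ 2) μ := by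
    refine (integrable_const ((∑ x ∈ B, ‖c x‖) ^ 2)).mono' (hQ_cont.norm.pow 2).aestronglyMeasurable
      (Filter.Eventually.of_forall fun θ => ?_)
    rw [Real.norm_eq_abs, abs_of_nonneg (by positivity)]
    exact pow_le_pow_left₀ (norm_nonneg _) (hQ_bdd θ) 2
  -- (a) `∫ g·conj Q = S`
  have hA : (∫ θ, g θ * conj (Q θ) ∂μ) = (S : ℂ) := by
    have h1 : ∀ θ, g θ * conj (Q θ) = ∑ x ∈ B, conj (c x) * (g θ * e x θ) := by
      intro θ
      simp only [hQ, map_sum, map_mul, Complex.conj_conj, Finset.mul_sum]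
      refine Finset.sum_congr rfl fun x _ => by ring
    simp_rw [h1]
    rw [integral_finsetSum _ fun x _ => (hge x).const_mul _]
    simp_rw [integral_const_mul]
    rw [hS]; push_cast
    refine Finset.sum_congr rfl fun x _ => ?_
    rw [show (∫ a, g a * e x a ∂μ) = c x from rfl, Complex.conj_mul']
  -- (b) `∫ |Q|² = Λ·S` (Parseval for the trigonometric polynomial `Q`)
  have hB : ∫ θ, ‖Q θ‖ ^ 2 ∂μ = Λ * S := by
    rw [hμ, hQ, hΛ, hS]
    exact integral_norm_sq_trigPoly_eq c B
  -- (c) pointwise expansion of `|g − Λ⁻¹Q|²`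
  have hexp : ∀ θ, ‖g θ - ((Λ⁻¹ : ℝ) : ℂ) * Q θ‖ ^ 2 = ‖g θ‖ ^ 2 + Λ⁻¹ ^ 2 * ‖Q θ‖ ^ 2 - 2 * Λ⁻¹ * (g θ * conj (Q θ)).re := by
    intro θ
    rw [show ∀ a b : ℂ, ‖a - b‖ ^ 2 = ‖a‖ ^ 2 + ‖b‖ ^ 2 - 2 * (a * conj b).re from fun a b => by
      simp only [Complex.sq_norm, Complex.normSq_sub], norm_mul, Complex.norm_real, Real.norm_eq_abs, abs_of_pos (inv_pos.2 hΛpos), mul_pow, map_mul,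
      Complex.conj_ofReal]
    have : (g θ * (((Λ⁻¹ : ℝ) : ℂ) * conj (Q θ))).re = Λ⁻¹ * (g θ * conj (Q θ)).re := by
      rw [show g θ * (((Λ⁻¹ : ℝ) : ℂ) * conj (Q θ)) = ((Λ⁻¹ : ℝ) : ℂ) * (g θ * conj (Q θ)) by ring, Complex.re_ofReal_mul]
    rw [this]; ring
  have hgQre : Integrable (fun θ => (g θ * conj (Q θ)).re) μ := by
    have := hgQ.re; simpa only [RCLike.re_to_complex] using this
  have hAre : ∫ θ, (g θ * conj (Q θ)).re ∂μ = S := by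
    have := integral_re hgQ; simp only [RCLike.re_to_complex] at this; rw [this, hA, Complex.ofReal_re]
  -- (d) positivity
  have hpos : 0 ≤ ∫ θ, ‖g θ - ((Λ⁻¹ : ℝ) : ℂ) * Q θ‖ ^ 2 ∂μ := integral_nonneg fun θ => by positivity
  have hcalc : ∫ θ, ‖g θ - ((Λ⁻¹ : ℝ) : ℂ) * Q θ‖ ^ 2 ∂μ = (∫ θ, ‖g θ‖ ^ 2 ∂μ) - Λ⁻¹ * S := by
    simp_rw [hexp]
    have i0 : Integrable (fun θ => Λ⁻¹ ^ 2 * ‖Q θ‖ ^ 2) μ := hQ2.const_mul _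
    have i1 : Integrable (fun θ => ‖g θ‖ ^ 2 + Λ⁻¹ ^ 2 * ‖Q θ‖ ^ 2) μ := hg2μ.add i0
    have i2 : Integrable (fun θ => 2 * Λ⁻¹ * (g θ * conj (Q θ)).re) μ := hgQre.const_mul _
    rw [integral_sub i1 i2, integral_add hg2μ i0, integral_const_mul, integral_const_mul, hB, hAre]
    field_simp; ring
  have hkey : Λ⁻¹ * S ≤ ∫ θ, ‖g θ‖ ^ 2 ∂μ := by linarith
  calc S = Λ * (Λ⁻¹ * S) := by field_simp
    _ ≤ Λ * ∫ θ, ‖g θ‖ ^ 2 ∂μ := mul_le_mul_of_nonneg_left hkey hΛpos.le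

/-! ## §3 The discrete second Riesz transforms `∇_a∇_b Δ⁻¹` are `ℓ²`-bounded on finitely supported charges -/

/-- `|e^{ia} − 1|² = 2(1 − cos a)` (private: the public twin lives in px15's `…BrillouinMultiplierBessel`). [folklore] -/
private theorem norm_cexp_I_mul_sub_one_sq (a : ℝ) : ‖cexp (I * a) - 1‖ ^ 2 = 2 * (1 - Real.cos a) := by
  have h : cexp (I * a) - 1 = ((Real.cos a - 1 : ℝ) : ℂ) + ((Real.sin a : ℝ) : ℂ) * I := by
    rw [show I * (a : ℂ) = (a : ℂ) * I by ring, Complex.exp_mul_I, ← Complex.ofReal_cos, ← Complex.ofReal_sin]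
    push_cast; ring
  rw [h, Complex.sq_norm, Complex.normSq_add_mul_I]
  nlinarith [Real.sin_sq_add_cos_sq a]

/-- `|e^{ia} − 1|·|e^{ib} − 1| ≤ (1 − cos a) + (1 − cos b)` (AM–GM). [folklore] -/
theorem norm_cexp_sub_one_mul_le (a b : ℝ) :
    ‖cexp (I * a) - 1‖ * ‖cexp (I * b) - 1‖ ≤ (1 - Real.cos a) + (1 - Real.cos b) := by
  nlinarith [two_mul_le_add_sq ‖cexp (I * a) - 1‖ ‖cexp (I * b) - 1‖, norm_cexp_I_mul_sub_one_sq a,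
    norm_cexp_I_mul_sub_one_sq b]

/-- One term of the dispersion: `1 − cos θ_a ≤ ε(θ)` (private: public twin in px15's `…BrillouinMultiplierBessel`). [folklore] -/
private theorem one_sub_cos_le_dispersion (θ : Fin d → ℝ) (a : Fin d) : 1 - Real.cos (θ a) ≤ dispersion θ :=
  Finset.single_le_sum (f := fun i => 1 - Real.cos (θ i)) (fun _ _ => sub_nonneg.2 (Real.cos_le_one _)) (Finset.mem_univ a)

/-- **The multiplier of `∇_a∇_bΔ⁻¹` is bounded by `2`**: `|(e^{iθ_a} − 1)(e^{iθ_b} − 1)·ε(θ)⁻¹| ≤ 2` (value `0` at `ε = 0`). [folklore] -/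
theorem norm_rieszMultiplier_le (θ : Fin d → ℝ) (a b : Fin d) :
    ‖(cexp (I * θ a) - 1) * (cexp (I * θ b) - 1) * (((dispersion θ)⁻¹ : ℝ) : ℂ)‖ ≤ 2 := by
  rcases eq_or_lt_of_le (dispersion_nonneg θ) with h0 | hpos; · rw [← h0]; simp
  · rw [norm_mul, norm_mul, Complex.norm_real, Real.norm_eq_abs, abs_of_pos (inv_pos.2 hpos), ← div_eq_mul_inv,
      div_le_iff₀ hpos]
    have := norm_cexp_sub_one_mul_le (θ a) (θ b)
    have ha := one_sub_cos_le_dispersion θ a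
    have hb := one_sub_cos_le_dispersion θ b
    linarith

/-- The multiplier is measurable in `θ`. [folklore] -/
theorem measurable_rieszMultiplier (a b : Fin d) :
    Measurable fun θ : Fin d → ℝ => (cexp (I * θ a) - 1) * (cexp (I * θ b) - 1) * (((dispersion θ)⁻¹ : ℝ) : ℂ) := by
  have h1 : Continuous fun θ : Fin d → ℝ => (cexp (I * θ a) - 1) * (cexp (I * θ b) - 1) := by fun_prop
  exact h1.measurable.mul (Complex.measurable_ofReal.comp ((continuous_dispersion (d := d)).measurable.inv))

/-- `θ·e_a = θ_a`. [folklore] -/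
theorem phase_single (θ : Fin d → ℝ) (a : Fin d) : phase θ (Pi.single a 1) = θ a := by
  unfold SRW.phase
  rw [Finset.sum_eq_single a (fun i _ hia => by simp [hia]) (fun h => absurd (Finset.mem_univ a) h)]
  simp

/-- **The second difference of a character**:
`e^{iθ·(z+e_a+e_b)} − e^{iθ·(z+e_a)} − e^{iθ·(z+e_b)} + e^{iθ·z} = (e^{iθ_a} − 1)(e^{iθ_b} − 1)·e^{iθ·z}`. [folklore] -/
theorem cexp_phase_secondDiff (θ : Fin d → ℝ) (z : Site d) (a b : Fin d) :
    cexp (I * phase θ (z + Pi.single a 1 + Pi.single b 1)) - cexp (I * phase θ (z + Pi.single a 1)) -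
        cexp (I * phase θ (z + Pi.single b 1)) + cexp (I * phase θ z) =
      (cexp (I * θ a) - 1) * (cexp (I * θ b) - 1) * cexp (I * phase θ z) := by
  simp only [phase_add, phase_single, Complex.ofReal_add, mul_add, Complex.exp_add]
  ring

/-- `θ ↦ e^{iθ·z}·ε(θ)⁻¹` is integrable on the Brillouin zone for `d ≥ 3`. [folklore] -/
theorem integrableOn_cexp_mul_inv_dispersion (hd : 3 ≤ d) (z : Site d) :
    IntegrableOn (fun θ : Fin d → ℝ => cexp (I * phase θ z) * (((dispersion θ)⁻¹ : ℝ) : ℂ)) (brillouin d) := by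
  have h1 : IntegrableOn (fun θ : Fin d → ℝ => (((dispersion θ)⁻¹ : ℝ) : ℂ)) (brillouin d) := by
    have := (integrable_indicator_inv_dispersion d hd)
    rw [integrable_indicator_iff (measurableSet_brillouin d)] at this
    exact (this.congr (Filter.Eventually.of_forall fun θ => one_div (dispersion θ))).ofReal
  exact h1.bdd_mul (continuous_cexp_I_phase z).aestronglyMeasurable
    (Filter.Eventually.of_forall fun θ => (norm_cexp_I_phase θ z).le)

/-- **The lattice Green function as the real part of a character integral** (`d ≥ 3`):
`G(z) = Re(∫_{[-π,π]^d} e^{iθ·z}·ε(θ)⁻¹ dθ) ∕ (2π)^d`. [folklore] -/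
theorem latticeGreen_eq_re_integral (hd : 3 ≤ d) (z : Site d) :
    latticeGreen z = (∫ θ in brillouin d, cexp (I * phase θ z) * (((dispersion θ)⁻¹ : ℝ) : ℂ)).re / (2 * π) ^ d := by
  unfold latticeGreen
  congr 1
  have hint : IntegrableOn (fun θ : Fin d → ℝ => cexp (I * phase θ z) * (((dispersion θ)⁻¹ : ℝ) : ℂ)) (brillouin d) := by
    exact integrableOn_cexp_mul_inv_dispersion hd z
  have hre := integral_re hint
  simp only [RCLike.re_to_complex] at hre
  rw [← hre]
  refine setIntegral_congr_fun (measurableSet_brillouin d) fun θ _ => ?_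
  rw [show I * (phase θ z : ℂ) = ((phase θ z : ℝ) : ℂ) * I by ring, Complex.re_mul_ofReal, Complex.exp_ofReal_mul_I_re]
  unfold SRW.phase
  rw [div_eq_mul_inv]

/-- ★★★ **THE DISCRETE SECOND RIESZ TRANSFORMS ARE `ℓ²`-CONTRACTIONS UP TO `2`** (`d ≥ 3`).  For a real charge `ω` on a finite set `S ⊆ ℤ^d`, the mixed
second difference `∇_a∇_b` of its lattice potential `G ∗ ω` (`G = latticeGreen`, twice the Green function of `−Δ`) satisfies, on EVERY finite box `B`,
`∑_{x∈B} (∑_{y∈S} ω(y)·∇_a∇_bG(x − y))² ≤ 4·∑_{y∈S} ω(y)²` — uniformly in `B`, `S` and the supports (the Fourier multiplier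
`(e^{iθ_a}−1)(e^{iθ_b}−1)∕ε(θ)` is bounded by `2`; Bessel + Parseval on `[-π,π]^d`). For `G₀ = G∕2` the constant is `1`. [folklore] -/
theorem sum_sq_secondDiff_latticeGreen_conv_le (hd : 3 ≤ d) (a b : Fin d) (S B : Finset (Site d)) (ω : Site d → ℝ) :
    ∑ x ∈ B, (∑ y ∈ S, ω y * (latticeGreen (x - y + Pi.single a 1 + Pi.single b 1) - latticeGreen (x - y + Pi.single a 1)
        - latticeGreen (x - y + Pi.single b 1) + latticeGreen (x - y))) ^ 2 ≤ 4 * ∑ y ∈ S, ω y ^ 2 := by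
  haveI hfin : IsFiniteMeasure ((volume : Measure (Fin d → ℝ)).restrict (brillouin d)) :=
    ⟨by rw [Measure.restrict_apply_univ]; exact (isCompact_brillouin d).measure_lt_top⟩
  set Λ : ℝ := (2 * π) ^ d with hΛ
  have hΛpos : 0 < Λ := by positivity
  set e : Site d → (Fin d → ℝ) → ℂ := fun x θ => cexp (I * phase θ x) with he
  set m : (Fin d → ℝ) → ℂ := fun θ => (cexp (I * θ a) - 1) * (cexp (I * θ b) - 1) * (((dispersion θ)⁻¹ : ℝ) : ℂ) with hm
  set ωhat : (Fin d → ℝ) → ℂ := fun θ => ∑ y ∈ S, (ω y : ℂ) * conj (e y θ) with hωhat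
  set g : (Fin d → ℝ) → ℂ := fun θ => m θ * ωhat θ with hg
  set W : ℝ := ∑ y ∈ S, |ω y| with hW
  have he_norm : ∀ x θ, ‖e x θ‖ = 1 := fun x θ => norm_cexp_I_phase θ x
  have he_cont : ∀ x, Continuous (e x) := fun x => continuous_cexp_I_phase x
  have hm_meas : Measurable m := measurable_rieszMultiplier a b
  have hm_bdd : ∀ θ, ‖m θ‖ ≤ 2 := fun θ => norm_rieszMultiplier_le θ a b
  have hωhat_cont : Continuous ωhat :=
    continuous_finsetSum _ fun y _ => continuous_const.mul (Complex.continuous_conj.comp (he_cont y))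
  have hωhat_bdd : ∀ θ, ‖ωhat θ‖ ≤ W := fun θ => (norm_sum_le _ _).trans (Finset.sum_le_sum fun y _ => by
    rw [norm_mul, Complex.norm_conj, he_norm, mul_one, Complex.norm_real, Real.norm_eq_abs])
  have hg_meas : AEStronglyMeasurable g ((volume : Measure (Fin d → ℝ)).restrict (brillouin d)) :=
    (hm_meas.mul hωhat_cont.measurable).aestronglyMeasurable
  have hg_bdd : ∀ θ, ‖g θ‖ ≤ 2 * W := fun θ => by
    rw [hg, norm_mul]; exact mul_le_mul (hm_bdd θ) (hωhat_bdd θ) (norm_nonneg _) (by norm_num)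
  have hgI : IntegrableOn g (brillouin d) :=
    (integrable_const (2 * W)).mono' hg_meas (Filter.Eventually.of_forall hg_bdd)
  have hg2I : IntegrableOn (fun θ => ‖g θ‖ ^ 2) (brillouin d) := by
    refine (integrable_const ((2 * W) ^ 2)).mono' (hg_meas.norm.pow 2) (Filter.Eventually.of_forall fun θ => ?_)
    rw [Real.norm_eq_abs, abs_of_nonneg (by positivity)]
    exact pow_le_pow_left₀ (norm_nonneg _) (hg_bdd θ) 2
  -- Step 1: `∇_a∇_bG(z) = Re(∫ m·e_z) ∕ Λ`
  have hI := integrableOn_cexp_mul_inv_dispersion hd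
  have hint1 : ∀ z : Site d, IntegrableOn (fun θ => m θ * e z θ) (brillouin d) := fun z =>
    (integrable_const (2 : ℝ)).mono' (hm_meas.mul (he_cont z).measurable).aestronglyMeasurable
      (Filter.Eventually.of_forall fun θ => by rw [norm_mul, he_norm, mul_one]; exact hm_bdd θ)
  have hD : ∀ z : Site d, latticeGreen (z + Pi.single a 1 + Pi.single b 1) - latticeGreen (z + Pi.single a 1)
      - latticeGreen (z + Pi.single b 1) + latticeGreen z = (∫ θ in brillouin d, m θ * e z θ).re / Λ := by
    intro z
    set F : Site d → (Fin d → ℝ) → ℂ := fun w θ => cexp (I * phase θ w) * (((dispersion θ)⁻¹ : ℝ) : ℂ) with hF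
    have hsplit : (∫ θ in brillouin d, m θ * e z θ) =
        (((∫ θ in brillouin d, F (z + Pi.single a 1 + Pi.single b 1) θ) - ∫ θ in brillouin d, F (z + Pi.single a 1) θ) -
          ∫ θ in brillouin d, F (z + Pi.single b 1) θ) + ∫ θ in brillouin d, F z θ := by
      have hfun : (fun θ => m θ * e z θ) =
          fun θ => ((F (z + Pi.single a 1 + Pi.single b 1) θ - F (z + Pi.single a 1) θ) - F (z + Pi.single b 1) θ) + F z θ := by
        funext θ
        simp only [hm, he, hF]
        have := cexp_phase_secondDiff θ z a b
        linear_combination (((dispersion θ)⁻¹ : ℝ) : ℂ) * this.symm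
      have i12 : Integrable (fun θ => F (z + Pi.single a 1 + Pi.single b 1) θ - F (z + Pi.single a 1) θ)
          ((volume : Measure (Fin d → ℝ)).restrict (brillouin d)) := (hI _).sub (hI _)
      have i123 : Integrable (fun θ => (F (z + Pi.single a 1 + Pi.single b 1) θ - F (z + Pi.single a 1) θ) - F (z + Pi.single b 1) θ)
          ((volume : Measure (Fin d → ℝ)).restrict (brillouin d)) := i12.sub (hI _)
      rw [hfun, integral_add i123 (hI _), integral_sub i12 (hI _), integral_sub (hI _) (hI _)]
    simp only [latticeGreen_eq_re_integral hd, hsplit, Complex.add_re, Complex.sub_re, hF]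
    ring
  -- Step 2: the inner sum at `x` is `Re(∫ g·e_x) ∕ Λ`
  have hinner : ∀ x : Site d, ∑ y ∈ S, ω y * (latticeGreen (x - y + Pi.single a 1 + Pi.single b 1) - latticeGreen (x - y + Pi.single a 1)
        - latticeGreen (x - y + Pi.single b 1) + latticeGreen (x - y)) = (∫ θ in brillouin d, g θ * e x θ).re / Λ := by
    intro x
    simp_rw [hD]
    have h1 : ∑ y ∈ S, ω y * ((∫ θ in brillouin d, m θ * e (x - y) θ).re / Λ) =
        (∑ y ∈ S, ((ω y : ℂ) * ∫ θ in brillouin d, m θ * e (x - y) θ).re) / Λ := by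
      rw [Finset.sum_div]
      refine Finset.sum_congr rfl fun y _ => ?_
      rw [Complex.re_ofReal_mul]; ring
    rw [h1, ← Complex.re_sum]
    congr 2
    simp_rw [← integral_const_mul]
    rw [← integral_finsetSum _ fun y _ => (hint1 (x - y)).const_mul _]
    refine setIntegral_congr_fun (measurableSet_brillouin d) fun θ _ => ?_
    simp only [hg, hωhat, Finset.mul_sum, Finset.sum_mul]
    refine Finset.sum_congr rfl fun y _ => ?_
    simp only [he]
    rw [← cexp_mul_conj_cexp θ x y]
    ring
  -- Step 3: Bessel, the multiplier bound, Parseval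
  have hBes := sum_norm_sq_fourierCoeff_le g hgI hg2I B
  have hPar : ∫ θ in brillouin d, ‖ωhat θ‖ ^ 2 = Λ * ∑ y ∈ S, ω y ^ 2 := by
    have := integral_norm_sq_trigPoly_eq (d := d) (fun y => (ω y : ℂ)) S
    simp only [Complex.norm_real, Real.norm_eq_abs, sq_abs] at this
    rw [hωhat, hΛ]
    exact this
  have hωhat2I : IntegrableOn (fun θ => ‖ωhat θ‖ ^ 2) (brillouin d) := by
    refine (integrable_const (W ^ 2)).mono' (hωhat_cont.norm.pow 2).aestronglyMeasurable (Filter.Eventually.of_forall fun θ => ?_)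
    rw [Real.norm_eq_abs, abs_of_nonneg (by positivity)]
    exact pow_le_pow_left₀ (norm_nonneg _) (hωhat_bdd θ) 2
  have hg2_le : ∫ θ in brillouin d, ‖g θ‖ ^ 2 ≤ 4 * (Λ * ∑ y ∈ S, ω y ^ 2) := by
    rw [← hPar, ← integral_const_mul]
    refine integral_mono_of_nonneg (Filter.Eventually.of_forall fun θ => by positivity) (hωhat2I.const_mul 4)
      (Filter.Eventually.of_forall fun θ => ?_)
    show ‖g θ‖ ^ 2 ≤ 4 * ‖ωhat θ‖ ^ 2
    rw [hg, norm_mul, mul_pow]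
    have := hm_bdd θ
    have h4 : ‖m θ‖ ^ 2 ≤ 2 ^ 2 := pow_le_pow_left₀ (norm_nonneg _) this 2
    nlinarith [sq_nonneg ‖ωhat θ‖]
  -- Step 4: assemble
  simp_rw [hinner]
  have hterm : ∀ x ∈ B, ((∫ θ in brillouin d, g θ * e x θ).re / Λ) ^ 2 ≤ ‖∫ θ in brillouin d, g θ * e x θ‖ ^ 2 / Λ ^ 2 := by
    intro x _
    rw [div_pow]
    refine div_le_div_of_nonneg_right ?_ (by positivity)
    rw [← sq_abs]
    exact pow_le_pow_left₀ (abs_nonneg _) (Complex.abs_re_le_norm _) 2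
  refine (Finset.sum_le_sum hterm).trans ?_
  rw [← Finset.sum_div, div_le_iff₀ (by positivity)]
  calc ∑ x ∈ B, ‖∫ θ in brillouin d, g θ * e x θ‖ ^ 2 ≤ Λ * ∫ θ in brillouin d, ‖g θ‖ ^ 2 := hBes
    _ ≤ Λ * (4 * (Λ * ∑ y ∈ S, ω y ^ 2)) := mul_le_mul_of_nonneg_left hg2_le hΛpos.le
    _ = (4 * ∑ y ∈ S, ω y ^ 2) * Λ ^ 2 := by ring

end Summit.QuantumFields.YangMills.Theorems.CovariantDischargeLatticeRieszL2

end
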